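/-
Copyright (c) 2026 the pub-hodgecm-mathlib formalisation cell (harness21).  Prover seat hodgecm-mathlib-K2E1-p09 (g5), Track B ∕ K2-LIT,
h413 = `stmt-HodgeConjecture-24833`, line `K2_E1_TraceFormulaBeta`, page «EIS-RANK-ONE», deal [D1] «EIS-R6d₂-residuals → R6e-inputs (N = 2)» of the
dealer K2E1-plan (g3) 2026-09-04T05:34:55Z, part (D1-d) (name of record 05:47:52Z): the `hdec` PLUG — `E(f_z) − E(f_z)_B` is BOUNDED in the cusp of
`U(1,1)` over a CM field, for flat sections of a continuous bounded level-`U` section `φ` with the archimedean input fibrewise (edition A).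
-/
import Summits.HodgeConjecture.HodgeConjecture.Theorems.K2E1EisensteinMinusConstantTermCuspBoundU2   -- ★ p857628: the cusp bound from Poisson ∕ dilation ∕ `hdec`
import Summits.HodgeConjecture.HodgeConjecture.Theorems.K2E1FlatSectionLineRestrictionU2           -- ★ (D1-c) I: periodicity, `hΦc`, `hΦi`, `hloc` along the line
import Summits.HodgeConjecture.HodgeConjecture.Theorems.K2E1AdelicFourierEnvelope                  -- ★ p857712 (K2E4-p10 (g3)): the fibrewise envelope `exists_envelope`
import Summits.HodgeConjecture.HodgeConjecture.Theorems.K2E1AdelicFourierDecay                     -- ★ p857643 (K2E4-p10 (g3)): the decay class `exists_forall_tsum_indicator_norm_mul_le_rpow_neg`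
import Summits.HodgeConjecture.HodgeConjecture.Theorems.K2E1EisensteinAnalyticBinders              -- ★ p857524: `hfin_of_locallyUniformMajorant`
import Summits.HodgeConjecture.HodgeConjecture.Theorems.K2E1BorelEisensteinGodementCMTwo           -- ★ R2 CM two: `summable_…_cm_two`, `exists_locallyUniform_majorant_flatSectionU_cm_two`
import Summits.HodgeConjecture.HodgeConjecture.Theorems.K2E1HeightFunctionU3                       -- ★ p857223: `borelHeight_one`
import Summits.HodgeConjecture.HodgeConjecture.Theorems.K2E1TruncatedEisensteinBoundedCMTwo        -- ★ p857723 (K2E4-p11 (g3)): `Λ^T E(f_z)` bounded modulo `hdec`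
import Literature.NumberTheory.Automorphic.UnitaryGroupIwasawaAdelic                               -- ★ Iwasawa at the CM pair `exists_mem_borelAdelic_mul_mem_standardMaximalCompactGL_cm`
import Literature.NumberTheory.Automorphic.UnitaryGroupIwasawaIntegration                          -- ★ `isCompact_comap_adelicVal_standardMaximalCompactGL`
import Literature.NumberTheory.Automorphic.UnitaryGroupBorelConstantTermInvariance                 -- ★ `conj_mem_adelicUnipotent`
import HarnessLib

/-!
# h413 ∕ Track B «K2-LIT», «EIS-RANK-ONE» R6d₂ (D1-d) — `K2E1EisensteinMinusConstantTermBoundedCMTwo`: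
# `∃ M₁, ∀ g, T < H(g) → ‖E(f_z)(g) − E(f_z)_B(g)‖ ≤ M₁` on `U(J₂)` over a CM field — the `hdec` plug of ★ `K2E1TruncatedEisensteinBoundedCMTwo`

Cell `pub/hodgecm-mathlib`, crux H413 = `stmt-HodgeConjecture-24833`, route `HCCMUnconditional`; dealer K2E1-plan (g3), deal [D1] 05:34:55Z, rulings «R6d-FIBREWISE»
05:44:38Z and 05:47:52Z (name of record).  THEOREMS ONLY (no `def`, no `instance`, no `notation`, no named-fact hypothesis, no `sorry`); lane `--kind proof --supports
stmt-HodgeConjecture-24833 --as helper` (count-neutral).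

THE ASSEMBLY (edition A: the archimedean input in the FIBREWISE FOURIER-DECAY form of ★ `exists_envelope`).  For the CM pair `(L⁺, L, c)`, `G = U(J₂)`, a continuous
bounded `φ : G(𝔸) → ℂ`, left-`B(L⁺)`-invariant, right-invariant under an open subgroup `U ≤ K_U`, whose flat section `f_z = φ·H^z` (`1 < Re z`) obeys the section law of a
unitary Hecke character `χ` (`hf`, the letter of ★ (b-i)), and for every Haar `ν` on `N(𝔸)`, every `ν`-fundamental domain `𝓕` of `N(L⁺)` WITH COMPACT CLOSURE, every additive
Haar `μ, μ₁, μ₂` on `𝔸_{L⁺}, (L⁺)_∞, 𝔸_{L⁺}^∞`:  IF the big-cell sections along the line `Φ_k(t) = f_z(ι(w₀)·n(θ t)·k)` have fibrewise archimedean Fourier decay of some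
order `m > [L⁺:ℚ]` with `L¹` majorants `A_k` of uniformly bounded mass `N₂` for `k ∈ K_U` (`hA`, `hdecArch` — the (iii″) binder of ★ p857712; discharged from archimedean smoothness of
`φ` in edition B ∕ [D5]), THEN `E(f_z) − E(f_z)_B` is bounded on `{T < H}` (`T ≥ 1`).  Every other input is ★ and discharged HERE by name:
Iwasawa `G(𝔸) = N·T·K_U` (★ `exists_mem_borelAdelic_mul_mem_standardMaximalCompactGL_cm` + ★ `torusPart` + ★ `conj_mem_adelicUnipotent` + ★ `middleRootUnipotent_two_surjective`),
`H = 1 ≤ T` on `K_U` (★ `borelHeight_one`), Godement `hfin` (★ `hfin_of_locallyUniformMajorant` + ★ R2 CM `exists_locallyUniform_majorant_flatSectionU_cm_two`), `hs` (★ R2 CM),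
`hΦc`∕`hΦi`∕`hloc` (★ (D1-c) I), `hnorm` (★ (D1-a)), the level `𝔫` (★ (D1-c) I, ONE for all of `K_U`), the envelope (★ p857712, `M := c·N₂`, `C_f` from `𝔫`), the decay class
(★ p857643 at order `m`, exponent `θ := m`, `β := m∕[L⁺:ℚ]`), and the cusp bound (★ p857628, `1 ≤ Re z + β`).

* §1 plumbing (any quadratic `(F, E, c)`): `unipotent_mul_of_borelLaw` (`f(n y) = f(y)` from the section law `hf`), `borelHeight_eq_one_of_mem_maximalCompact` (`H = 1` on `K_U`),
  `exists_chart_torus_of_borel_mul` (the Iwasawa shape `g = n(θ x_u)·t·k` of ★ p857628's `hIw` from `g = b·k`).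
* §2 **`exists_bound_sub_borelConstantTerm_cm_two`** (edition A, THE HEAD) and its 1-call corollary through ★ p857723
  **`exists_norm_truncation_flatSectionU_le_cm_two`**: `∃ M, ∀ g, ‖Λ^T E(f_z) g‖ ≤ M` (= FILE 2's `hΛbdd` at `N = 2`, CM, modulo the fibrewise archimedean binder).

HONEST LABEL.  Count-neutral helper; proves no printed statement; HC_CM is proved only modulo the 7 printed citations (2 remaining named inputs: hLiu418 =
`stmt-HodgeConjecture-24832`, h413 = `stmt-HodgeConjecture-24833`) until rung 0 closes.  The archimedean binder (`hA`, `hdecArch`) is NOT discharged here.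

## References
* [MoeglinWaldspurger1995] C. Mœglin, J.-L. Waldspurger, *Spectral decomposition and Eisenstein series* (1995), I.2.10–I.2.13, II.1.7.
* [Garrett2018] P. Garrett, *Modern Analysis of Automorphic Forms by Example* 1 (2018), §2.8–§2.11 (`E − E_P` is of rapid decay on Siegel sets; truncation).
* [Rogawski1990] J. D. Rogawski, *Automorphic Representations of Unitary Groups in Three Variables* (1990), §1.10, §2.2.
-/

set_option autoImplicit false
set_option linter.dupNamespace false  -- the mandated namespace repeats the summit's segment (`HodgeConjecture.HodgeConjecture`)

noncomputable section

open MeasureTheory Measure Filter Topology NumberField IsDedekindDomain MulAction Module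
open Literature.NumberTheory.Automorphic Literature.NumberTheory.Automorphic.UnitaryGroup Literature.NumberTheory.GaloisRepresentations
open Summit.HodgeConjecture.HodgeConjecture.Cruxes.H413.K2E1BorelEisensteinU
open Summit.HodgeConjecture.HodgeConjecture.Cruxes.H413.K2E1EisensteinMinusConstantTermCuspBoundU2
open Summit.HodgeConjecture.HodgeConjecture.Cruxes.H413.K2E1FlatSectionLineRestrictionU2
open Summit.HodgeConjecture.HodgeConjecture.Cruxes.H413.K2E1UnipotentHaarNormalisationU2
open Summit.HodgeConjecture.HodgeConjecture.Cruxes.H413.K2E1AdelicFourierEnvelope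
open Summit.HodgeConjecture.HodgeConjecture.Cruxes.H413.K2E1AdelicFourierDecay
open Summit.HodgeConjecture.HodgeConjecture.Cruxes.H413.K2E1EisensteinAnalyticBinders
open Summit.HodgeConjecture.HodgeConjecture.Cruxes.H413.K2E1BorelEisensteinGodementCMTwo
open Summit.HodgeConjecture.HodgeConjecture.Cruxes.H413.K2E1TruncatedEisensteinBoundedCMTwo
open NumberField.mixedEmbedding
-- `Classical` is needed to see the Mathlib normed-space instances on `mixedSpace` (note H5 of `AdelicGLnGlue`)
open scoped ENNReal NNReal Classical

namespace Summit.HodgeConjecture.HodgeConjecture.Cruxes.H413.K2E1EisensteinMinusConstantTermBoundedCMTwo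

/-! ## §1 Plumbing (any quadratic `(F, E, c)`) -/

section Quadratic

variable {F E : Type} [Field F] [NumberField F] [Field E] [NumberField E] [Algebra F E] {c : E ≃ₐ[F] E}

/-- **A section obeying the Borel law of a character is left-`N(𝔸_F)`-invariant**: the law `f(b g) = χ(b₀₀)·‖b₀₀‖^z·f(g)` (★ (b-i)'s letter `hf`) at a unipotent `b = n`
(`n₁₀ = 0`, `n₀₀ = 1`) reads `f(n g) = f(g)`. [cite: MoeglinWaldspurger1995, II.1.5] -/
theorem unipotent_mul_of_borelLaw (χ : HeckeCharacter E) (z : ℂ) {f : (quasiSplit F E c 2).Adelic → ℂ}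
    (hf : ∀ (b g : (quasiSplit F E c 2).Adelic) (u : (AdeleRing (𝓞 E) E)ˣ),
      ((b.1 : GL (Fin 2) (AdeleRing (𝓞 E) E)) : Matrix (Fin 2) (Fin 2) (AdeleRing (𝓞 E) E)) 1 0 = 0 →
      (u : (AdeleRing (𝓞 E) E)) = ((b.1 : GL (Fin 2) (AdeleRing (𝓞 E) E)) : Matrix (Fin 2) (Fin 2) (AdeleRing (𝓞 E) E)) 0 0 →
        f (b * g) = ((χ u : ℂˣ) : ℂ) * ((ideleNorm u : ℝ) : ℂ) ^ z * f g) :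
    ∀ (n : ↥(adelicUnipotent F E c 2)) (y : (quasiSplit F E c 2).Adelic), f ((n : (quasiSplit F E c 2).Adelic) * y) = f y := by
  intro n y
  obtain ⟨hupper, hdiag⟩ := (mem_upperUnitriangular_iff _).1 ((mem_adelicUnipotent_iff (n : (quasiSplit F E c 2).Adelic)).1 n.2)
  have h10 : (((n : (quasiSplit F E c 2).Adelic).1 : GL (Fin 2) (AdeleRing (𝓞 E) E)) : Matrix (Fin 2) (Fin 2) (AdeleRing (𝓞 E) E)) 1 0 = 0 :=
    hupper (show (0 : Fin 2) < 1 by decide)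
  have h00 : ((1 : (AdeleRing (𝓞 E) E)ˣ) : AdeleRing (𝓞 E) E) =
      (((n : (quasiSplit F E c 2).Adelic).1 : GL (Fin 2) (AdeleRing (𝓞 E) E)) : Matrix (Fin 2) (Fin 2) (AdeleRing (𝓞 E) E)) 0 0 := by
    rw [Units.val_one]; exact (hdiag 0).symm
  have h := hf (n : (quasiSplit F E c 2).Adelic) y 1 h10 h00
  rw [map_one, Units.val_one, ideleNorm_eq_one_of_mem_principalIdeles (Subgroup.one_mem _), Complex.ofReal_one, Complex.one_cpow,
    one_mul, one_mul] at h
  exact h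

/-- **`H ≤ T` on `K_U`**: `H(k) = H(1) = 1` for `k ∈ K_U = adelicVal⁻¹(K_∞·GL₂(𝒪̂_E))` (★ `borelHeight_mul_of_mem_comap_standardMaximalCompactGL`, ★ `borelHeight_one`).
[cite: Garrett2018, §2.2] -/
theorem borelHeight_eq_one_of_mem_maximalCompact {N : ℕ} [NeZero N] {k : (quasiSplit F E c N).Adelic}
    (hk : k ∈ ((standardMaximalCompactGL N E).comap (adelicVal F E c N ((StdForm.antidiagonal N).over E)) : Subgroup (quasiSplit F E c N).Adelic)) :
    borelHeight k = 1 := by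
  rw [← one_mul k, borelHeight_mul_of_mem_comap_standardMaximalCompactGL hk, K2E1HeightFunctionU3.borelHeight_one]

/-- **THE IWASAWA SHAPE `g = n(θ x_u)·t·k` of ★ p857628's `hIw`** from a Borel × compact decomposition `g = b·k`: `b = (b t_b⁻¹)·t_b` with `b t_b⁻¹ ∈ N(𝔸_F)` (★ `torusPart`,
★ `torusPart_inv_mul_mem_adelicUnipotent`, ★ `conj_mem_adelicUnipotent`), and `N(𝔸_F) = n(θ(𝔸_F))` (★ `middleRootUnipotent_two_surjective`, ★ `traceZeroLine`).
[cite: Rogawski1990, §1.10] [cite: MoeglinWaldspurger1995, I.2.1] -/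
theorem exists_chart_torus_of_borel_mul [Algebra.IsQuadraticExtension F E]
    (hij : (((0 : Fin 2) : ℕ)) + 1 = ((1 : Fin 2) : ℕ)) (hN : 2 = 2 * ((0 : Fin 2) : ℕ) + 2) {δ : E} (hcδ : c δ = -δ) (hδ : δ ≠ 0)
    {K : Set (quasiSplit F E c 2).Adelic}
    (hIw : ∀ g : (quasiSplit F E c 2).Adelic, ∃ b ∈ borelAdelic F E c 2, ∃ k ∈ K, g = b * k) (g : (quasiSplit F E c 2).Adelic) :
    ∃ (xu : AdeleRing (𝓞 F) F) (t : ↥(torusInBorel F E c 2)), ∃ k ∈ K,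
      g = ((middleRootUnipotent hij hN (Multiplicative.ofAdd (traceZeroLine F E c hcδ hδ xu)) : ↥(adelicUnipotent F E c 2)) : (quasiSplit F E c 2).Adelic) *
        ((t : borelAdelic F E c 2) : (quasiSplit F E c 2).Adelic) * k := by
  obtain ⟨b, hb, k, hk, rfl⟩ := hIw g
  set B : borelAdelic F E c 2 := ⟨b, hb⟩ with hB
  -- the torus part and the unipotent part `b t⁻¹ = t (t⁻¹ b) t⁻¹ ∈ N(𝔸_F)`
  have ht : torusPart B ∈ torusInBorel F E c 2 := (mem_torusInBorel_iff _).2 (torusPart_mem_torusAdelic B)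
  have hu : (((torusPart B)⁻¹ * B : borelAdelic F E c 2) : (quasiSplit F E c 2).Adelic) ∈ adelicUnipotent F E c 2 :=
    torusPart_inv_mul_mem_adelicUnipotent B
  have hconj := conj_mem_adelicUnipotent (Subgroup.inv_mem _ (torusPart B).2) hu
  have hBb : ((B : borelAdelic F E c 2) : (quasiSplit F E c 2).Adelic) = b := rfl
  have hval : ((((torusPart B : borelAdelic F E c 2)) : (quasiSplit F E c 2).Adelic)⁻¹)⁻¹ *
      ((((torusPart B)⁻¹ * B : borelAdelic F E c 2)) : (quasiSplit F E c 2).Adelic) *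
        (((torusPart B : borelAdelic F E c 2)) : (quasiSplit F E c 2).Adelic)⁻¹ =
      b * (((torusPart B : borelAdelic F E c 2)) : (quasiSplit F E c 2).Adelic)⁻¹ := by
    rw [inv_inv, Subgroup.coe_mul, Subgroup.coe_inv, hBb]; group
  rw [hval] at hconj
  obtain ⟨y, hy⟩ := middleRootUnipotent_two_surjective hij hN ⟨_, hconj⟩
  have hy' : ((middleRootUnipotent hij hN (Multiplicative.ofAdd y) : ↥(adelicUnipotent F E c 2)) : (quasiSplit F E c 2).Adelic) =
      b * (((torusPart B : borelAdelic F E c 2)) : (quasiSplit F E c 2).Adelic)⁻¹ := congrArg Subtype.val hy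
  refine ⟨(traceZeroLine F E c hcδ hδ).symm y, ⟨torusPart B, ht⟩, k, hk, ?_⟩
  rw [ContinuousAddEquiv.apply_symm_apply, hy']
  show b * k = b * (((torusPart B : borelAdelic F E c 2)) : (quasiSplit F E c 2).Adelic)⁻¹ * (((torusPart B : borelAdelic F E c 2)) : (quasiSplit F E c 2).Adelic) * k
  rw [inv_mul_cancel_right]

end Quadratic

/-! ## §2 The `hdec` plug at the CM pair -/

section CM

variable (L : Type) [Field L] [NumberField L] [IsCMField L]
  (hij : (((0 : Fin 2) : ℕ)) + 1 = ((1 : Fin 2) : ℕ)) (hN : 2 = 2 * ((0 : Fin 2) : ℕ) + 2)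
  [MeasurableSpace (quasiSplit (↥(maximalRealSubfield L)) L (IsCMField.complexConj L) 2).Adelic] [BorelSpace (quasiSplit (↥(maximalRealSubfield L)) L (IsCMField.complexConj L) 2).Adelic]
  [MeasurableSpace (AdeleRing (𝓞 L) L)] [BorelSpace (AdeleRing (𝓞 L) L)]
  [MeasurableSpace (AdeleRing (𝓞 ↥(maximalRealSubfield L)) ↥(maximalRealSubfield L))] [BorelSpace (AdeleRing (𝓞 ↥(maximalRealSubfield L)) ↥(maximalRealSubfield L))]
  [MeasurableSpace (InfiniteAdeleRing ↥(maximalRealSubfield L))] [BorelSpace (InfiniteAdeleRing ↥(maximalRealSubfield L))]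
  [MeasurableSpace (FiniteAdeleRing (𝓞 ↥(maximalRealSubfield L)) ↥(maximalRealSubfield L))] [BorelSpace (FiniteAdeleRing (𝓞 ↥(maximalRealSubfield L)) ↥(maximalRealSubfield L))]

/-- **(D1-d), EDITION A — `E(f_z) − E(f_z)_B` IS BOUNDED IN THE CUSP OF `U(1,1)` OVER A CM FIELD.**  See the module docstring for the list of inputs; the only non-★ input is
the fibrewise archimedean Fourier decay of the big-cell sections `Φ_k(a, b) = f_z(ι(w₀)·n(θ(a,b))·k)`, `k ∈ K_U`, of order `m > [L⁺:ℚ]` with `L¹` majorants `A k` of mass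
`≤ N₂` (`hA`, `hdecArch`).  Conclusion: `∃ M₁, ∀ g, T < H(g) → ‖E(f_z)(g) − E(f_z)_B(g)‖ ≤ M₁`.
[cite: MoeglinWaldspurger1995, I.2.10–I.2.12, II.1.7] [cite: Garrett2018, §2.9] -/
theorem exists_bound_sub_borelConstantTerm_cm_two {δ : L} (hcδ : IsCMField.complexConj L δ = -δ) (hδ : δ ≠ 0)
    (ν : Measure ↥(adelicUnipotent ↥(maximalRealSubfield L) L (IsCMField.complexConj L) 2)) [ν.IsHaarMeasure]
    {𝓕 : Set ↥(adelicUnipotent ↥(maximalRealSubfield L) L (IsCMField.complexConj L) 2)} (h𝓕 : IsFundamentalDomain ↥(rationalUnipotent ↥(maximalRealSubfield L) L (IsCMField.complexConj L) 2) 𝓕 ν)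
    (h𝓕c : IsCompact (closure 𝓕))
    (μ : Measure (AdeleRing (𝓞 ↥(maximalRealSubfield L)) ↥(maximalRealSubfield L))) [μ.IsAddHaarMeasure]
    (μ₁ : Measure (InfiniteAdeleRing ↥(maximalRealSubfield L))) [μ₁.IsAddHaarMeasure] (μ₂ : Measure (FiniteAdeleRing (𝓞 ↥(maximalRealSubfield L)) ↥(maximalRealSubfield L))) [μ₂.IsAddHaarMeasure]
    (χ : HeckeCharacter L) (hχ : χ.IsUnitary) {z : ℂ} (hz : 1 < z.re)
    {φ : (quasiSplit (↥(maximalRealSubfield L)) L (IsCMField.complexConj L) 2).Adelic → ℂ} (hφc : Continuous φ) {Mφ : ℝ} (hφM : ∀ x, ‖φ x‖ ≤ Mφ)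
    (hφB : ∀ b ∈ borelU ((IsCMField.complexConj L : L ≃ₐ[↥(maximalRealSubfield L)] L) : L →+* L) ((StdForm.antidiagonal 2).over L), ∀ x : (quasiSplit (↥(maximalRealSubfield L)) L (IsCMField.complexConj L) 2).Adelic, φ ((quasiSplit (↥(maximalRealSubfield L)) L (IsCMField.complexConj L) 2).toAdelic b * x) = φ x)
    (hf : ∀ (b g : (quasiSplit (↥(maximalRealSubfield L)) L (IsCMField.complexConj L) 2).Adelic) (u : (AdeleRing (𝓞 L) L)ˣ),
      ((b.1 : GL (Fin 2) (AdeleRing (𝓞 L) L)) : Matrix (Fin 2) (Fin 2) (AdeleRing (𝓞 L) L)) 1 0 = 0 →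
      (u : (AdeleRing (𝓞 L) L)) = ((b.1 : GL (Fin 2) (AdeleRing (𝓞 L) L)) : Matrix (Fin 2) (Fin 2) (AdeleRing (𝓞 L) L)) 0 0 →
        flatSectionU φ z (b * g) = ((χ u : ℂˣ) : ℂ) * ((ideleNorm u : ℝ) : ℂ) ^ z * flatSectionU φ z g)
    {U : Subgroup (quasiSplit (↥(maximalRealSubfield L)) L (IsCMField.complexConj L) 2).Adelic} (hUo : IsOpen (U : Set (quasiSplit (↥(maximalRealSubfield L)) L (IsCMField.complexConj L) 2).Adelic)) (hUK : U ≤ ((standardMaximalCompactGL 2 L).comap (adelicVal ↥(maximalRealSubfield L) L (IsCMField.complexConj L) 2 ((StdForm.antidiagonal 2).over L)) : Subgroup (quasiSplit (↥(maximalRealSubfield L)) L (IsCMField.complexConj L) 2).Adelic))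
    (hφU : ∀ u ∈ U, ∀ y : (quasiSplit (↥(maximalRealSubfield L)) L (IsCMField.complexConj L) 2).Adelic, φ (y * u) = φ y)
    {T : ℝ≥0} (hT : 1 ≤ T) {m : ℕ} (hm : (finrank ℚ ↥(maximalRealSubfield L) : ℝ) < m)
    -- the fibrewise archimedean binder (★ p857712's (iii″) for the big-cell sections along the line, uniformly on `K_U`)
    {A : (quasiSplit (↥(maximalRealSubfield L)) L (IsCMField.complexConj L) 2).Adelic → FiniteAdeleRing (𝓞 ↥(maximalRealSubfield L)) ↥(maximalRealSubfield L) → ℝ} {N₂ : ℝ} (hN₂ : 0 ≤ N₂)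
    (hA : ∀ k ∈ ((standardMaximalCompactGL 2 L).comap (adelicVal ↥(maximalRealSubfield L) L (IsCMField.complexConj L) 2 ((StdForm.antidiagonal 2).over L)) : Subgroup (quasiSplit (↥(maximalRealSubfield L)) L (IsCMField.complexConj L) 2).Adelic), Integrable (A k) μ₂ ∧ ∫ b, A k b ∂μ₂ ≤ N₂)
    (hdecArch : ∀ k ∈ ((standardMaximalCompactGL 2 L).comap (adelicVal ↥(maximalRealSubfield L) L (IsCMField.complexConj L) 2 ((StdForm.antidiagonal 2).over L)) : Subgroup (quasiSplit (↥(maximalRealSubfield L)) L (IsCMField.complexConj L) 2).Adelic), ∀ (b : FiniteAdeleRing (𝓞 ↥(maximalRealSubfield L)) ↥(maximalRealSubfield L)) (y : InfiniteAdeleRing ↥(maximalRealSubfield L)),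
      ‖∫ a, flatSectionU φ z (((quasiSplit (↥(maximalRealSubfield L)) L (IsCMField.complexConj L) 2).toAdelic (weylLongU ((IsCMField.complexConj L : L ≃ₐ[↥(maximalRealSubfield L)] L) : L →+* L) (rfl : ((StdForm.antidiagonal 2).over L) = ((StdForm.antidiagonal 2).over L)))) *
          ((middleRootUnipotent hij hN (Multiplicative.ofAdd (traceZeroLine ↥(maximalRealSubfield L) L (IsCMField.complexConj L) hcδ hδ ((a, b) : AdeleRing (𝓞 ↥(maximalRealSubfield L)) ↥(maximalRealSubfield L)))) : ↥(adelicUnipotent ↥(maximalRealSubfield L) L (IsCMField.complexConj L) 2)) : (quasiSplit (↥(maximalRealSubfield L)) L (IsCMField.complexConj L) 2).Adelic) * k) *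
        (adeleAddChar ↥(maximalRealSubfield L) (infiniteAdeleInl ↥(maximalRealSubfield L) (y * a)) : ℂ) ∂μ₁‖ ≤ A k b * (1 + ‖InfiniteAdeleRing.ringEquiv_mixedSpace ↥(maximalRealSubfield L) y‖) ^ (-(m : ℝ))) :
    ∃ M₁ : ℝ, ∀ g : (quasiSplit (↥(maximalRealSubfield L)) L (IsCMField.complexConj L) 2).Adelic, T < borelHeight g →
      ‖eisensteinSeriesU (flatSectionU φ z) g - borelConstantTerm ν 𝓕 (eisensteinSeriesU (flatSectionU φ z)) g‖ ≤ M₁ := by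
  classical
  -- the CM pair
  haveI : Algebra.IsQuadraticExtension ↥(maximalRealSubfield L) L := IsCMField.isQuadraticExtension L
  haveI : LocallyCompactSpace (AdeleRing (𝓞 L) L) := locallyCompactSpace_adeleRing' L
  have hc : (IsCMField.complexConj L) * (IsCMField.complexConj L) = 1 := AlgEquiv.ext fun x => IsCMField.complexConj_apply_apply L x
  -- letters: `f_z = flatSectionU φ z`
  have hfc : Continuous (flatSectionU φ z) := continuous_flatSectionU hφc z
  have hfm : Measurable (flatSectionU φ z) := hfc.measurable
  have hfB := flatSectionU_toAdelic_mul hφB z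
  have hfN : ∀ (n : ↥(adelicUnipotent ↥(maximalRealSubfield L) L (IsCMField.complexConj L) 2)) (y : (quasiSplit (↥(maximalRealSubfield L)) L (IsCMField.complexConj L) 2).Adelic),
      flatSectionU φ z ((n : (quasiSplit (↥(maximalRealSubfield L)) L (IsCMField.complexConj L) 2).Adelic) * y) = flatSectionU φ z y :=
    unipotent_mul_of_borelLaw χ z hf
  have hfU : ∀ u ∈ U, ∀ y : (quasiSplit (↥(maximalRealSubfield L)) L (IsCMField.complexConj L) 2).Adelic, flatSectionU φ z (y * u) = flatSectionU φ z y :=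
    flatSectionU_mul_of_mem hUK hφU z
  -- the compact `K_U`, Iwasawa, heights on `K_U`
  have hKc : IsCompact (((standardMaximalCompactGL 2 L).comap (adelicVal ↥(maximalRealSubfield L) L (IsCMField.complexConj L) 2 ((StdForm.antidiagonal 2).over L)) : Subgroup (quasiSplit (↥(maximalRealSubfield L)) L (IsCMField.complexConj L) 2).Adelic) : Set (quasiSplit (↥(maximalRealSubfield L)) L (IsCMField.complexConj L) 2).Adelic) := isCompact_comap_adelicVal_standardMaximalCompactGL
  have hIw' : ∀ g : (quasiSplit (↥(maximalRealSubfield L)) L (IsCMField.complexConj L) 2).Adelic, ∃ b ∈ borelAdelic ↥(maximalRealSubfield L) L (IsCMField.complexConj L) 2, ∃ k ∈ (((standardMaximalCompactGL 2 L).comap (adelicVal ↥(maximalRealSubfield L) L (IsCMField.complexConj L) 2 ((StdForm.antidiagonal 2).over L)) : Subgroup (quasiSplit (↥(maximalRealSubfield L)) L (IsCMField.complexConj L) 2).Adelic) : Set (quasiSplit (↥(maximalRealSubfield L)) L (IsCMField.complexConj L) 2).Adelic), g = b * k := fun g => by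
    obtain ⟨b, hb, k, hk, hg⟩ := exists_mem_borelAdelic_mul_mem_standardMaximalCompactGL_cm L g
    exact ⟨b, hb, k, Subgroup.mem_comap.2 hk, hg⟩
  have hIw := exists_chart_torus_of_borel_mul hij hN hcδ hδ hIw'
  have hK : ∀ k ∈ (((standardMaximalCompactGL 2 L).comap (adelicVal ↥(maximalRealSubfield L) L (IsCMField.complexConj L) 2 ((StdForm.antidiagonal 2).over L)) : Subgroup (quasiSplit (↥(maximalRealSubfield L)) L (IsCMField.complexConj L) 2).Adelic) : Set (quasiSplit (↥(maximalRealSubfield L)) L (IsCMField.complexConj L) 2).Adelic), (borelHeight k : ℝ) ≤ (T : ℝ) := fun k hk => by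
    rw [borelHeight_eq_one_of_mem_maximalCompact hk, NNReal.coe_one]; exact_mod_cast hT
  -- the fundamental domain
  haveI := locallyCompactSpace_traceZeroAdele (F := ↥(maximalRealSubfield L)) (E := L) (c := (IsCMField.complexConj L))
  obtain ⟨h𝓕₀, h𝓕top⟩ := measure_fundamentalDomain_ne_zero_and_lt_top_two hij hN hc (Measure.addHaar : Measure ↥(traceZeroAdele ↥(maximalRealSubfield L) L (IsCMField.complexConj L))) ν h𝓕
  -- Godement at the CM pair: the locally uniform majorant of the left Eisenstein terms of `f`
  have hmaj := fun y₀ : (quasiSplit (↥(maximalRealSubfield L)) L (IsCMField.complexConj L) 2).Adelic => exists_locallyUniform_majorant_flatSectionU_cm_two L hz hφM y₀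
  have hcont : ∀ q : Quotient (orbitRel ↥(borelU ((IsCMField.complexConj L : L ≃ₐ[↥(maximalRealSubfield L)] L) : L →+* L) ((StdForm.antidiagonal 2).over L)) ↥(unitaryGroupOfForm ((IsCMField.complexConj L : L ≃ₐ[↥(maximalRealSubfield L)] L) : L →+* L) ((StdForm.antidiagonal 2).over L))),
      Continuous fun y : (quasiSplit (↥(maximalRealSubfield L)) L (IsCMField.complexConj L) 2).Adelic => flatSectionU φ z ((quasiSplit (↥(maximalRealSubfield L)) L (IsCMField.complexConj L) 2).toAdelic (q.out : ↥(unitaryGroupOfForm ((IsCMField.complexConj L : L ≃ₐ[↥(maximalRealSubfield L)] L) : L →+* L) ((StdForm.antidiagonal 2).over L))) * y) :=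
    fun q => hfc.comp (continuous_const.mul continuous_id)
  have hfin := fun g : (quasiSplit (↥(maximalRealSubfield L)) L (IsCMField.complexConj L) 2).Adelic => hfin_of_locallyUniformMajorant ν hfB hcont hmaj h𝓕c g
  have hs := fun g : (quasiSplit (↥(maximalRealSubfield L)) L (IsCMField.complexConj L) 2).Adelic => (summable_eisensteinSeriesU_flatSectionU_cm_two L hz hφM g).of_norm
  -- the Poisson binders along the line (★ (D1-c) I) and the normalisation (★ (D1-a))
  have hΦc := fun g : (quasiSplit (↥(maximalRealSubfield L)) L (IsCMField.complexConj L) 2).Adelic => continuous_weylLong_mul_line_mul hij hN hcδ hδ hfc g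
  have hΦi := fun g : (quasiSplit (↥(maximalRealSubfield L)) L (IsCMField.complexConj L) 2).Adelic => integrable_weylLong_mul_line_mul_two hij hN hcδ hδ μ ν hfm hfN hfB h𝓕 g (hfin g)
  have hloc := fun (g : (quasiSplit (↥(maximalRealSubfield L)) L (IsCMField.complexConj L) 2).Adelic) (C₀ : Set (AdeleRing (𝓞 ↥(maximalRealSubfield L)) ↥(maximalRealSubfield L))) (hC₀ : IsCompact C₀) =>
    exists_summable_majorant_line_translate_two hij hN hcδ hδ hfB hmaj hC₀ g
  have hnorm := forall_inv_measure_smul_integral_weylLong_eq_two hij hN hcδ hδ hc μ ν h𝓕 (flatSectionU φ z)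
  -- ONE level `𝔫` for all of `K_U` (★ (D1-c) I), then the envelope constants (★ p857712) and the decay constant (★ p857643)
  obtain ⟨𝔫, h𝔫, hper⟩ := exists_levelIdeal_forall_line_periodic_two' hij hN hcδ hδ hKc hUo hfU
  obtain ⟨cE, hcE, Cf, hCfc, henv⟩ := exists_envelope ↥(maximalRealSubfield L) μ μ₁ μ₂ h𝔫
  have hM0 : 0 ≤ cE * N₂ := mul_nonneg hcE.le hN₂
  have hmm : (m : ℝ) ≤ ((m : ℕ) : ℝ) := le_rfl
  obtain ⟨C, hC0, hdecay⟩ := exists_forall_tsum_indicator_norm_mul_le_rpow_neg ↥(maximalRealSubfield L) hM0 hCfc hm hmm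
  -- the archimedean binder ⟹ the decay class, for every `k ∈ K_U`
  have hd : 0 < (finrank ℚ ↥(maximalRealSubfield L) : ℝ) := Nat.cast_pos.2 finrank_pos
  have hσβ : 1 ≤ z.re + (m : ℝ) / (finrank ℚ ↥(maximalRealSubfield L) : ℝ) := le_add_of_le_of_nonneg hz.le (div_nonneg (Nat.cast_nonneg m) hd.le)
  have hdec : ∀ k ∈ (((standardMaximalCompactGL 2 L).comap (adelicVal ↥(maximalRealSubfield L) L (IsCMField.complexConj L) 2 ((StdForm.antidiagonal 2).over L)) : Subgroup (quasiSplit (↥(maximalRealSubfield L)) L (IsCMField.complexConj L) 2).Adelic) : Set (quasiSplit (↥(maximalRealSubfield L)) L (IsCMField.complexConj L) 2).Adelic), ∀ Λ' : (AdeleRing (𝓞 ↥(maximalRealSubfield L)) ↥(maximalRealSubfield L))ˣ, 1 ≤ ((IdeleClassGroup.ideleNorm ↥(maximalRealSubfield L) Λ' : ℝ≥0) : ℝ) →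
      (Summable fun ξ : ↥(maximalRealSubfield L) => ‖∫ v, (fun x : AdeleRing (𝓞 ↥(maximalRealSubfield L)) ↥(maximalRealSubfield L) => flatSectionU φ z (((quasiSplit (↥(maximalRealSubfield L)) L (IsCMField.complexConj L) 2).toAdelic (weylLongU ((IsCMField.complexConj L : L ≃ₐ[↥(maximalRealSubfield L)] L) : L →+* L) (rfl : ((StdForm.antidiagonal 2).over L) = ((StdForm.antidiagonal 2).over L)))) *
          ((middleRootUnipotent hij hN (Multiplicative.ofAdd (traceZeroLine ↥(maximalRealSubfield L) L (IsCMField.complexConj L) hcδ hδ x)) : ↥(adelicUnipotent ↥(maximalRealSubfield L) L (IsCMField.complexConj L) 2)) : (quasiSplit (↥(maximalRealSubfield L)) L (IsCMField.complexConj L) 2).Adelic) * k)) v *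
        (adeleAddChar ↥(maximalRealSubfield L) (algebraMap ↥(maximalRealSubfield L) (AdeleRing (𝓞 ↥(maximalRealSubfield L)) ↥(maximalRealSubfield L)) ξ * (Λ' : AdeleRing (𝓞 ↥(maximalRealSubfield L)) ↥(maximalRealSubfield L)) * v) : ℂ) ∂μ‖) ∧
      ∑' ξ : ↥(maximalRealSubfield L), ({0}ᶜ : Set ↥(maximalRealSubfield L)).indicator (fun ξ => ‖∫ v, (fun x : AdeleRing (𝓞 ↥(maximalRealSubfield L)) ↥(maximalRealSubfield L) => flatSectionU φ z (((quasiSplit (↥(maximalRealSubfield L)) L (IsCMField.complexConj L) 2).toAdelic (weylLongU ((IsCMField.complexConj L : L ≃ₐ[↥(maximalRealSubfield L)] L) : L →+* L) (rfl : ((StdForm.antidiagonal 2).over L) = ((StdForm.antidiagonal 2).over L)))) *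
          ((middleRootUnipotent hij hN (Multiplicative.ofAdd (traceZeroLine ↥(maximalRealSubfield L) L (IsCMField.complexConj L) hcδ hδ x)) : ↥(adelicUnipotent ↥(maximalRealSubfield L) L (IsCMField.complexConj L) 2)) : (quasiSplit (↥(maximalRealSubfield L)) L (IsCMField.complexConj L) 2).Adelic) * k)) v *
        (adeleAddChar ↥(maximalRealSubfield L) (algebraMap ↥(maximalRealSubfield L) (AdeleRing (𝓞 ↥(maximalRealSubfield L)) ↥(maximalRealSubfield L)) ξ * (Λ' : AdeleRing (𝓞 ↥(maximalRealSubfield L)) ↥(maximalRealSubfield L)) * v) : ℂ) ∂μ‖) ξ ≤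
        C * ((IdeleClassGroup.ideleNorm ↥(maximalRealSubfield L) Λ' : ℝ≥0) : ℝ) ^ (-((m : ℝ) / (finrank ℚ ↥(maximalRealSubfield L) : ℝ))) := by
    intro k hk Λ' _
    set Φ : AdeleRing (𝓞 ↥(maximalRealSubfield L)) ↥(maximalRealSubfield L) → ℂ := fun x => flatSectionU φ z (((quasiSplit (↥(maximalRealSubfield L)) L (IsCMField.complexConj L) 2).toAdelic (weylLongU ((IsCMField.complexConj L : L ≃ₐ[↥(maximalRealSubfield L)] L) : L →+* L) (rfl : ((StdForm.antidiagonal 2).over L) = ((StdForm.antidiagonal 2).over L)))) *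
      ((middleRootUnipotent hij hN (Multiplicative.ofAdd (traceZeroLine ↥(maximalRealSubfield L) L (IsCMField.complexConj L) hcδ hδ x)) : ↥(adelicUnipotent ↥(maximalRealSubfield L) L (IsCMField.complexConj L) 2)) : (quasiSplit (↥(maximalRealSubfield L)) L (IsCMField.complexConj L) 2).Adelic) * k) with hΦ
    have hΦprod : Integrable (fun p : InfiniteAdeleRing ↥(maximalRealSubfield L) × FiniteAdeleRing (𝓞 ↥(maximalRealSubfield L)) ↥(maximalRealSubfield L) => Φ (p.1, p.2)) (μ₁.prod μ₂) :=
      (integrable_iff_integrable_prod ↥(maximalRealSubfield L) μ μ₁ μ₂ Φ).1 (hΦi k)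
    obtain ⟨hAk, hAN⟩ := hA k hk
    obtain ⟨hMΨ, hCfΨ⟩ := henv Φ (A k) N₂ m hΦprod (fun a b l hl => hper k hk a b l hl) (fun b y => hdecArch k hk b y) hAk hAN
    exact hdecay (fun η => ∫ v, Φ v * (adeleAddChar ↥(maximalRealSubfield L) (η * v) : ℂ) ∂μ) hMΨ hCfΨ Λ'
  -- the cusp bound ★ p857628
  haveI := isInvInvariant_of_isHaarMeasure_two (F := ↥(maximalRealSubfield L)) (E := L) (c := IsCMField.complexConj L) ν
  refine ⟨(μ (adeleFundamentalDomain ↥(maximalRealSubfield L))).toReal⁻¹ * C, fun g hg => ?_⟩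
  have hg' : (T : ℝ) < (borelHeight g : ℝ) := by exact_mod_cast hg
  exact forall_norm_sub_borelConstantTerm_le_two hij hN hcδ hδ ν χ hχ z hfm hfN hfB hf h𝓕 h𝓕₀ h𝓕top.ne μ hC0 hσβ hK hIw
    hfin hs hΦc hΦi hloc hnorm hdec g hg'

/-- **`Λ^T E(f_z)` IS BOUNDED ON `U(J₂)(𝔸)` OVER A CM FIELD, modulo the fibrewise archimedean binder** — the 1-call composition of the head with ★ p857723
`exists_norm_truncation_eisensteinSeriesU_flatSectionU_le_cm_two` (`hcov`, `hlow` discharged there): `∃ M, ∀ g, ‖Λ^T E(f_z)(g)‖ ≤ M` = FILE 2's `hΛbdd` at `N = 2`.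
[cite: MoeglinWaldspurger1995, I.2.13, IV.2] [cite: Garrett2018, §2.10–§2.11] -/
theorem exists_norm_truncation_flatSectionU_le_cm_two {δ : L} (hcδ : IsCMField.complexConj L δ = -δ) (hδ : δ ≠ 0)
    (ν : Measure ↥(adelicUnipotent ↥(maximalRealSubfield L) L (IsCMField.complexConj L) 2)) [ν.IsHaarMeasure]
    {𝓕 : Set ↥(adelicUnipotent ↥(maximalRealSubfield L) L (IsCMField.complexConj L) 2)} (h𝓕 : IsFundamentalDomain ↥(rationalUnipotent ↥(maximalRealSubfield L) L (IsCMField.complexConj L) 2) 𝓕 ν)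
    (h𝓕c : IsCompact (closure 𝓕))
    (μ : Measure (AdeleRing (𝓞 ↥(maximalRealSubfield L)) ↥(maximalRealSubfield L))) [μ.IsAddHaarMeasure]
    (μ₁ : Measure (InfiniteAdeleRing ↥(maximalRealSubfield L))) [μ₁.IsAddHaarMeasure] (μ₂ : Measure (FiniteAdeleRing (𝓞 ↥(maximalRealSubfield L)) ↥(maximalRealSubfield L))) [μ₂.IsAddHaarMeasure]
    (χ : HeckeCharacter L) (hχ : χ.IsUnitary) {z : ℂ} (hz : 1 < z.re)
    {φ : (quasiSplit (↥(maximalRealSubfield L)) L (IsCMField.complexConj L) 2).Adelic → ℂ} (hφc : Continuous φ) {Mφ : ℝ} (hφM : ∀ x, ‖φ x‖ ≤ Mφ)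
    (hφB : ∀ b ∈ borelU ((IsCMField.complexConj L : L ≃ₐ[↥(maximalRealSubfield L)] L) : L →+* L) ((StdForm.antidiagonal 2).over L), ∀ x : (quasiSplit (↥(maximalRealSubfield L)) L (IsCMField.complexConj L) 2).Adelic, φ ((quasiSplit (↥(maximalRealSubfield L)) L (IsCMField.complexConj L) 2).toAdelic b * x) = φ x)
    (hf : ∀ (b g : (quasiSplit (↥(maximalRealSubfield L)) L (IsCMField.complexConj L) 2).Adelic) (u : (AdeleRing (𝓞 L) L)ˣ),
      ((b.1 : GL (Fin 2) (AdeleRing (𝓞 L) L)) : Matrix (Fin 2) (Fin 2) (AdeleRing (𝓞 L) L)) 1 0 = 0 →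
      (u : (AdeleRing (𝓞 L) L)) = ((b.1 : GL (Fin 2) (AdeleRing (𝓞 L) L)) : Matrix (Fin 2) (Fin 2) (AdeleRing (𝓞 L) L)) 0 0 →
        flatSectionU φ z (b * g) = ((χ u : ℂˣ) : ℂ) * ((ideleNorm u : ℝ) : ℂ) ^ z * flatSectionU φ z g)
    {U : Subgroup (quasiSplit (↥(maximalRealSubfield L)) L (IsCMField.complexConj L) 2).Adelic} (hUo : IsOpen (U : Set (quasiSplit (↥(maximalRealSubfield L)) L (IsCMField.complexConj L) 2).Adelic)) (hUK : U ≤ ((standardMaximalCompactGL 2 L).comap (adelicVal ↥(maximalRealSubfield L) L (IsCMField.complexConj L) 2 ((StdForm.antidiagonal 2).over L)) : Subgroup (quasiSplit (↥(maximalRealSubfield L)) L (IsCMField.complexConj L) 2).Adelic))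
    (hφU : ∀ u ∈ U, ∀ y : (quasiSplit (↥(maximalRealSubfield L)) L (IsCMField.complexConj L) 2).Adelic, φ (y * u) = φ y)
    {T : ℝ≥0} (hT : 1 ≤ T) {m : ℕ} (hm : (finrank ℚ ↥(maximalRealSubfield L) : ℝ) < m)
    {A : (quasiSplit (↥(maximalRealSubfield L)) L (IsCMField.complexConj L) 2).Adelic → FiniteAdeleRing (𝓞 ↥(maximalRealSubfield L)) ↥(maximalRealSubfield L) → ℝ} {N₂ : ℝ} (hN₂ : 0 ≤ N₂)
    (hA : ∀ k ∈ ((standardMaximalCompactGL 2 L).comap (adelicVal ↥(maximalRealSubfield L) L (IsCMField.complexConj L) 2 ((StdForm.antidiagonal 2).over L)) : Subgroup (quasiSplit (↥(maximalRealSubfield L)) L (IsCMField.complexConj L) 2).Adelic), Integrable (A k) μ₂ ∧ ∫ b, A k b ∂μ₂ ≤ N₂)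
    (hdecArch : ∀ k ∈ ((standardMaximalCompactGL 2 L).comap (adelicVal ↥(maximalRealSubfield L) L (IsCMField.complexConj L) 2 ((StdForm.antidiagonal 2).over L)) : Subgroup (quasiSplit (↥(maximalRealSubfield L)) L (IsCMField.complexConj L) 2).Adelic), ∀ (b : FiniteAdeleRing (𝓞 ↥(maximalRealSubfield L)) ↥(maximalRealSubfield L)) (y : InfiniteAdeleRing ↥(maximalRealSubfield L)),
      ‖∫ a, flatSectionU φ z (((quasiSplit (↥(maximalRealSubfield L)) L (IsCMField.complexConj L) 2).toAdelic (weylLongU ((IsCMField.complexConj L : L ≃ₐ[↥(maximalRealSubfield L)] L) : L →+* L) (rfl : ((StdForm.antidiagonal 2).over L) = ((StdForm.antidiagonal 2).over L)))) *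
          ((middleRootUnipotent hij hN (Multiplicative.ofAdd (traceZeroLine ↥(maximalRealSubfield L) L (IsCMField.complexConj L) hcδ hδ ((a, b) : AdeleRing (𝓞 ↥(maximalRealSubfield L)) ↥(maximalRealSubfield L)))) : ↥(adelicUnipotent ↥(maximalRealSubfield L) L (IsCMField.complexConj L) 2)) : (quasiSplit (↥(maximalRealSubfield L)) L (IsCMField.complexConj L) 2).Adelic) * k) *
        (adeleAddChar ↥(maximalRealSubfield L) (infiniteAdeleInl ↥(maximalRealSubfield L) (y * a)) : ℂ) ∂μ₁‖ ≤ A k b * (1 + ‖InfiniteAdeleRing.ringEquiv_mixedSpace ↥(maximalRealSubfield L) y‖) ^ (-(m : ℝ))) :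
    ∃ M : ℝ, ∀ g : (quasiSplit (↥(maximalRealSubfield L)) L (IsCMField.complexConj L) 2).Adelic, ‖truncation ν 𝓕 T (eisensteinSeriesU (flatSectionU φ z)) g‖ ≤ M := by
  obtain ⟨M₁, hdec⟩ := exists_bound_sub_borelConstantTerm_cm_two L hij hN hcδ hδ ν h𝓕 h𝓕c μ μ₁ μ₂ χ hχ hz hφc hφM hφB hf hUo hUK hφU hT hm hN₂
    hA hdecArch
  obtain ⟨M₀, h⟩ := exists_norm_truncation_eisensteinSeriesU_flatSectionU_le_cm_two L ν h𝓕 hT hz hφc hφM hφB hdec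
  exact ⟨max M₀ M₁, h⟩

end CM

end Summit.HodgeConjecture.HodgeConjecture.Cruxes.H413.K2E1EisensteinMinusConstantTermBoundedCMTwo

end
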